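/-
Copyright (c) 2026. All rights reserved.
Released under Apache 2.0 license as described in the file LICENSE.
-/
import Literature.NumberTheory.ComplexMultiplication.DegenerateCMTypesAbelianKernelsIndexFourMulPrime
import HarnessLib

/-!
# Kubota's defect by kernels V: kernels of INDEX `4p^{j+1}` (`p` an odd prime) — the characters of a cyclic quotient of order
# `4p^{j+1}` vanish on a CM type iff the type is EQUIDISTRIBUTED along the subgroup of order `p` of the quotient

T. Kubota [Kubota1965], §4 LEMMA 2 (defect = number of vanishing odd characters), grouped by KERNEL (tree
`DegenerateCMTypesAbelianKernels.typeRank_add_sum_totient_eq`).  The tree decides the kernels of index `2`, `4` (`…IndexFour`),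
`2p^{j+1}` (`…equidistributed_of_index`, F. Hazama's Lemma 4.6.1 mechanism [Hazama2003CyclicCM]) and `4p`
(`…IndexFourMulPrime`).  THIS FILE decides the kernels of INDEX `4p^{j+1}` for every `j` — on a CM field: the CM subfields `F = K^H`
with `Gal(F/ℚ) ≅ ℤ/4p^{j+1}` CYCLIC — so that, with the four decided cases, every admissible kernel of an abelian group of EXPONENT
`4p^k` is decided (e.g. the cyclic levels `37, 74` of the «φ = 36» band, `(ℤ/37)ˣ ≅ ℤ/36 = ℤ/4 × ℤ/9`).

* §1 **`I_notMem_adjoin_primePow`** (`i ∉ ℚ(ζ_{p^{j+1}})`: else `φ(4p^{j+1}) ≤ φ(p^{j+1})`), `eq_zero_of_add_I_mul_eq_zero_primePow`,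
  and **`periodic_of_sum_gaussian_mul_pow_eq_zero`**: `Σ_c (x_c + y_c i) ζ^c = 0` with `x_c, y_c ∈ ℤ` (`c ∈ ℤ/p^{j+1}`) forces
  `x(c + p^j) = x(c)` and `y(c + p^j) = y(c)` — the two Gaussian coordinates separate (`i ∉ ℚ(ζ)`) and each is governed by the tree's
  `PrimePow.sum_mul_pow_eq_zero_iff_periodic` (the rational relations among the `p^{j+1}`-th roots of unity are generated by the coset
  sums of the subgroup of order `p`, [Hazama2003CyclicCM] (4.4)–(4.5); [Washington1997] Prop. 2.4, Thm. 2.5).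
* §2 values `ε·ω^c` (`ε ∈ {±1, ±i}`, `c ∈ ℤ/p^{j+1}`; `μ_{4p^{j+1}} = μ₄ · μ_{p^{j+1}}`), **`sum_char_eq_sum_gaussian_fibres_primePow`**
  (`χ(S) = Σ_c ((N(ω^c) − N(−ω^c)) + (N(iω^c) − N(−iω^c))·i)·ω^c`), **`sum_char_eq_zero_iff_fibres_four_mul_primePow`** — for `χ` ODD
  with values in `μ_{4p^{j+1}}` and `ω = χ(u)` a primitive `p^{j+1}`-th root: `χ(S) = 0 ⟺ N(χ(g)·ω^{p^j}) = N(χ(g))` for every `g`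
  (⇒: periodicity of both Gaussian coordinates + `N(v) + N(−v) = #χ⁻¹(v)` + `#χ⁻¹(vω^c) = #χ⁻¹(v)`; ⇐: `ζ·χ(S) = χ(u^{p^j}S) = χ(S)`
  with `ζ = ω^{p^j} ≠ 1`).
* §3 COSET FORM: **`sum_char_eq_zero_iff_equidistributed_of_index_four_mul_primePow`** — for `χ` odd with `ker χ = H` of index `4p^{j+1}`
  and `G/H` cyclic: `χ(S) = 0 ⟺ #(S ∩ gxH) = #(S ∩ gH)` for all `g` and all `x` with `x^p ∈ H` (verbatim the index-`2p^{j+1}` and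
  index-`4p` conditions); **`forall_…_of_index_four_mul_primePow`** — all `φ(4p^{j+1}) = 2(p−1)p^j` characters of kernel `H` at once.

HONEST SCOPE.  A regrouping of Kubota's count (kernels of index `4p^{j+1}`), assembled from the tree's prime-power tools and the
`ℚ(i)`-disjointness of `ℚ(ζ_{p^{j+1}})`; not a printed formula — the printed ingredients are cited at each statement.  The case `j = 0` is
the neighbour `DegenerateCMTypesAbelianKernelsIndexFourMulPrime` (kept: its statements are the ones the exponent-`4p` file consumes).
THEOREMS ONLY: no definition, no named fact, no instance, no notation, no `sorry` (D-0026 net debt 0).  HC_CM is NOT proved; nothing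
here bears on it beyond the degenerate ∕ non-degenerate census of CM types.

## References

* [Kubota1965] T. Kubota, Trans. AMS 118 (1965), §4 Lemma 2 (held text, p. 119).
* [Hazama2003CyclicCM] F. Hazama, *Hodge cycles on abelian varieties with complex multiplication by cyclic CM-fields*, J. Math. Sci.
  Univ. Tokyo 10 (2003), Prop. 4.1, Prop. 4.3 (proof, (4.4)–(4.5)), Lemma 4.6.1.
* [Washington1997] L. C. Washington, *Introduction to Cyclotomic Fields*, 2nd ed., GTM 83, Prop. 2.4, Thm. 2.5
  (`[ℚ(ζ_{4n}) : ℚ] = 2φ(n)` for `n` odd: `i ∉ ℚ(ζ_n)`).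
* [White1993SporadicCycles] S. P. White, Compositio Math. 88 (1993), §4, proof of Lemma 3 (p. 131) (grouping by kernels).

## Provenance

pub-hodgecm2 (COR-CM), KEPT Literature lane `lit-deligne-3`, generation 64, file F64d (towards the cyclic levels `37, 74` of the «φ(N) = 36»
band).  Neighbours cited by name, nothing restated: `DegenerateCMTypesAbelianKernels` (`forall_sum_char_eq_zero_iff_exists`,
`exists_oddChar_ker`), `DegenerateCMTypesAbelianPrimePower` (`AbelianPrimePow.card_filter_neg`, `card_fibre_mul`),
`DegenerateCMTypesCyclicPrimePower` (`PrimePow.sum_mul_pow_eq_zero_iff_periodic`), `CyclotomicGaussianIndependence`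
(`CyclotomicGaussian.finrank_adjoin_eq_totient`).  The `[folklore]` helpers are private.
-/

noncomputable section

open scoped BigOperators Classical

namespace Literature.NumberTheory.ComplexMultiplication

namespace CyclicCMType

namespace AbelianKernels

open Literature.NumberTheory.NumberFields (CyclotomicGaussian.finrank_adjoin_eq_totient)
open IntermediateField

variable {G : Type*} [CommGroup G] [Fintype G] [DecidableEq G] {ρ : G} {Φ : Finset G} {p : ℕ}

/-! ## §0 Helpers -/

section Helpers

omit [Fintype G] [DecidableEq G] in
/-- `χ(gh) = χ(g)χ(h)`. [folklore] -/
private theorem char_mul₄ₚₖ (χ : AddChar (Additive G) ℂ) (g h : G) :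
    χ (Additive.ofMul (g * h)) = χ (Additive.ofMul g) * χ (Additive.ofMul h) := by
  rw [ofMul_mul, AddChar.map_add_eq_mul]

omit [Fintype G] [DecidableEq G] in
/-- `χ(g^e) = χ(g)^e`. [folklore] -/
private theorem char_pow₄ₚₖ (χ : AddChar (Additive G) ℂ) (g : G) (e : ℕ) :
    χ (Additive.ofMul (g ^ e)) = χ (Additive.ofMul g) ^ e := by
  rw [ofMul_pow, AddChar.map_nsmul_eq_pow]

omit [Fintype G] [DecidableEq G] in
/-- `χ(1) = 1`. [folklore] -/
private theorem char_one₄ₚₖ (χ : AddChar (Additive G) ℂ) : χ (Additive.ofMul (1 : G)) = 1 := by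
  rw [ofMul_one, AddChar.map_zero_eq_one]

omit [Fintype G] [DecidableEq G] in
/-- `χ(g) ≠ 0`. [folklore] -/
private theorem char_ne_zero₄ₚₖ (χ : AddChar (Additive G) ℂ) (g : G) : χ (Additive.ofMul g) ≠ 0 := by
  intro h0
  have := char_mul₄ₚₖ χ g g⁻¹
  rw [mul_inv_cancel, char_one₄ₚₖ, h0, zero_mul] at this
  exact one_ne_zero this

omit [Fintype G] [DecidableEq G] in
/-- `χ(s) = χ(g)` iff `g⁻¹s ∈ ker χ`. [folklore] -/
private theorem char_eq_iff_inv_mul_mem₄ₚₖ {H : Subgroup G} (χ : AddChar (Additive G) ℂ)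
    (hker : ∀ g : G, χ (Additive.ofMul g) = 1 ↔ g ∈ H) (g s : G) :
    χ (Additive.ofMul s) = χ (Additive.ofMul g) ↔ g⁻¹ * s ∈ H := by
  rw [← hker]
  have h1 : χ (Additive.ofMul (g⁻¹ * s)) * χ (Additive.ofMul g) = χ (Additive.ofMul s) := by
    rw [← char_mul₄ₚₖ, mul_comm g⁻¹ s, inv_mul_cancel_right]
  constructor
  · intro hs
    rw [hs] at h1
    exact mul_left_eq_self₀.1 h1 |>.resolve_right (char_ne_zero₄ₚₖ χ g)
  · intro h
    rw [h, one_mul] at h1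
    exact h1.symm

omit [Fintype G] [DecidableEq G] in
/-- `ρ² = 1` for the conjugation of a CM type. [folklore] -/
private theorem rho_mul_rho₄ₚₖ (h : IsCMTypeWith ρ (Φ : Set G)) : ρ * ρ = 1 := by
  simpa [smul_eq_mul] using h.invol (1 : G)

/-- **The fourth roots of unity in `ℂ`** are `1, −1, i, −i`. [folklore] -/
private theorem eq_of_pow_four_eq_one₄ₚₖ {z : ℂ} (hz : z ^ 4 = 1) :
    z = 1 ∨ z = -1 ∨ z = Complex.I ∨ z = -Complex.I := by
  have key : (z - 1) * (z + 1) * (z - Complex.I) * (z + Complex.I) = z ^ 4 - 1 := by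
    linear_combination (1 - z ^ 2) * Complex.I_sq
  rw [hz, sub_self] at key
  rcases mul_eq_zero.mp key with h | h
  · rcases mul_eq_zero.mp h with h | h
    · rcases mul_eq_zero.mp h with h | h
      · exact Or.inl (sub_eq_zero.mp h)
      · exact Or.inr (Or.inl (add_eq_zero_iff_eq_neg.mp h))
    · exact Or.inr (Or.inr (Or.inl (sub_eq_zero.mp h)))
  · exact Or.inr (Or.inr (Or.inr (add_eq_zero_iff_eq_neg.mp h)))

end Helpers

/-! ## §1 `i ∉ ℚ(ζ_{p^{j+1}})` and the Gaussian relations among the `p^{j+1}`-th roots of unity -/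

section Gaussian

open IntermediateField Polynomial

/-- **`i ∉ ℚ(ζ)`** for a primitive `p^{j+1}`-th root of unity `ζ`, `p` an odd prime: else `ℚ(ζ_{4p^{j+1}}) = ℚ(iζ) ⊆ ℚ(ζ)` and
`2φ(p^{j+1}) = φ(4p^{j+1}) ≤ φ(p^{j+1})`.  (The case `j = 0` is the tree's `CyclotomicGaussian.I_notMem_adjoin`.)
[cite: Washington1997, Prop. 2.4 and Thm. 2.5] -/
theorem I_notMem_adjoin_primePow {p j : ℕ} (hp : p.Prime) (hp2 : p ≠ 2) {ζ : ℂ} (hζ : IsPrimitiveRoot ζ (p ^ (j + 1))) :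
    Complex.I ∉ ℚ⟮ζ⟯ := by
  intro hI
  have hn0 : 0 < p ^ (j + 1) := pow_pos hp.pos _
  have hcop : Nat.Coprime 4 (p ^ (j + 1)) := by
    rw [show (4 : ℕ) = 2 ^ 2 by norm_num]
    exact ((Nat.coprime_primes Nat.prime_two hp).2 (Ne.symm hp2)).pow 2 (j + 1)
  -- `i ζ` is a primitive `4 p^{j+1}`-th root of unity
  have hI4 : IsPrimitiveRoot Complex.I 4 := by
    refine IsPrimitiveRoot.mk_of_lt Complex.I (by norm_num) Complex.I_pow_four fun l hl hl4 => ?_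
    interval_cases l
    · rw [pow_one]; intro h; simpa using congrArg Complex.im h
    · rw [Complex.I_sq]; intro h; have := congrArg Complex.re h; norm_num at this
    · rw [pow_succ, Complex.I_sq]; intro h; simpa using congrArg Complex.im h
  have hη : IsPrimitiveRoot (Complex.I * ζ) (4 * p ^ (j + 1)) := by
    have h4 : orderOf Complex.I = 4 := hI4.eq_orderOf.symm
    have hpo : orderOf ζ = p ^ (j + 1) := hζ.eq_orderOf.symm
    rw [IsPrimitiveRoot.iff_orderOf, (Commute.all _ _).orderOf_mul_eq_mul_orderOf_of_coprime (by rw [h4, hpo]; exact hcop),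
      h4, hpo]
  haveI : FiniteDimensional ℚ ℚ⟮ζ⟯ := adjoin.finiteDimensional ((hζ.isIntegral hn0).tower_top)
  have hle : ℚ⟮Complex.I * ζ⟯ ≤ ℚ⟮ζ⟯ := adjoin_simple_le_iff.2 (mul_mem hI (mem_adjoin_simple_self ℚ ζ))
  have h4 : Nat.totient 4 = 2 := by decide
  have h := finrank_le_of_le_right hle
  rw [CyclotomicGaussian.finrank_adjoin_eq_totient (by omega) hη, CyclotomicGaussian.finrank_adjoin_eq_totient hn0 hζ,
    Nat.totient_mul hcop, h4] at h
  have := Nat.totient_pos.2 hn0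
  omega

/-- `a + i·b = 0` with `a, b ∈ ℚ(ζ)` (`ζ` a primitive `p^{j+1}`-th root of unity, `p` odd) forces `a = b = 0`.
[cite: Washington1997, Prop. 2.4] -/
theorem eq_zero_of_add_I_mul_eq_zero_primePow {p j : ℕ} (hp : p.Prime) (hp2 : p ≠ 2) {ζ : ℂ}
    (hζ : IsPrimitiveRoot ζ (p ^ (j + 1))) {a b : ℂ} (ha : a ∈ ℚ⟮ζ⟯) (hb : b ∈ ℚ⟮ζ⟯) (h : a + Complex.I * b = 0) :
    a = 0 ∧ b = 0 := by
  by_cases hb0 : b = 0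
  · refine ⟨?_, hb0⟩
    rwa [hb0, mul_zero, add_zero] at h
  · exfalso
    apply I_notMem_adjoin_primePow hp hp2 hζ
    have hI : Complex.I = -a / b := by
      field_simp
      linear_combination h
    rw [hI]
    exact div_mem (neg_mem ha) hb

/-- **`Σ_c (x_c + y_c·i) ζ^c = 0` with `x_c, y_c ∈ ℤ` (`c ∈ ℤ/p^{j+1}`) forces `x` AND `y` to be `p^j`-PERIODIC**: `x(c + p^j) = x(c)`,
`y(c + p^j) = y(c)` — the `ℚ(i)`-linear relations among the `p^{j+1}`-th roots of unity are generated by the coset sums of the subgroup of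
order `p` (the tree's `PrimePow.sum_mul_pow_eq_zero_iff_periodic` on each Gaussian coordinate, the coordinates separated by
`i ∉ ℚ(ζ_{p^{j+1}})`). [cite: Hazama2003CyclicCM, Prop. 4.3 (proof, (4.4)–(4.5))] [cite: Washington1997, Prop. 2.4 and Thm. 2.5] -/
theorem periodic_of_sum_gaussian_mul_pow_eq_zero {p j : ℕ} [Fact p.Prime] (hp2 : p ≠ 2) {ζ : ℂ}
    (hζ : IsPrimitiveRoot ζ (p ^ (j + 1))) (x y : ZMod (p ^ (j + 1)) → ℤ)
    (h : ∑ c : ZMod (p ^ (j + 1)), ((x c : ℂ) + (y c : ℂ) * Complex.I) * ζ ^ c.val = 0) :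
    (∀ c, x (c + (p ^ j : ℕ)) = x c) ∧ (∀ c, y (c + (p ^ j : ℕ)) = y c) := by
  have hp : p.Prime := Fact.out
  haveI : NeZero (p ^ (j + 1)) := ⟨pow_ne_zero _ hp.ne_zero⟩
  haveI : NeZero (p ^ j) := ⟨pow_ne_zero _ hp.ne_zero⟩
  have hsplit : (∑ c : ZMod (p ^ (j + 1)), (x c : ℂ) * ζ ^ c.val) + Complex.I * (∑ c : ZMod (p ^ (j + 1)), (y c : ℂ) * ζ ^ c.val) = 0 := by
    rw [Finset.mul_sum, ← Finset.sum_add_distrib, ← h]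
    exact Finset.sum_congr rfl fun c _ => by ring
  have hmem : ∀ z : ZMod (p ^ (j + 1)) → ℤ, (∑ c : ZMod (p ^ (j + 1)), (z c : ℂ) * ζ ^ c.val) ∈ ℚ⟮ζ⟯ := fun z =>
    sum_mem fun c _ => mul_mem (intCast_mem ℚ⟮ζ⟯ (z c)) (pow_mem (mem_adjoin_simple_self ℚ ζ) _)
  obtain ⟨hx, hy⟩ := eq_zero_of_add_I_mul_eq_zero_primePow hp hp2 hζ (hmem x) (hmem y) hsplit
  exact ⟨(PrimePow.sum_mul_pow_eq_zero_iff_periodic (p := p) (q := p ^ j) (m := j) rfl (pow_succ' p j) hζ x).1 hx,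
    (PrimePow.sum_mul_pow_eq_zero_iff_periodic (p := p) (q := p ^ j) (m := j) rfl (pow_succ' p j) hζ y).1 hy⟩

end Gaussian

/-! ## §2 Characters with values in the `4p^{j+1}`-th roots of unity: the values `ε·ω^c` and the character sum on the fibres -/

section Values

variable [hp : Fact p.Prime] {u : G} {j : ℕ} {χ : AddChar (Additive G) ℂ}

omit [Fintype G] [DecidableEq G] in
/-- `ω^{(c + m).val} = ω^{c.val} · ω^m` for `ω = χ(u)` a primitive `p^{j+1}`-th root of unity. [folklore] -/
private theorem pow_val_add₄ₚₖ (hu : IsPrimitiveRoot (χ (Additive.ofMul u)) (p ^ (j + 1))) (c : ZMod (p ^ (j + 1))) (m : ℕ) :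
    χ (Additive.ofMul u) ^ (c + (m : ZMod (p ^ (j + 1)))).val = χ (Additive.ofMul u) ^ c.val * χ (Additive.ofMul u) ^ m := by
  have h1 := pow_mod_orderOf (χ (Additive.ofMul u)) (c.val + m % p ^ (j + 1))
  have h2 := pow_mod_orderOf (χ (Additive.ofMul u)) m
  rw [← hu.eq_orderOf] at h1 h2
  rw [ZMod.val_add, ZMod.val_natCast, h1, pow_add, h2]

omit [Fintype G] [DecidableEq G] in
/-- `4` is a unit modulo the odd prime power `p^{j+1}`. [folklore] -/
private theorem isUnit_four₄ₚₖ (hp2 : p ≠ 2) : IsUnit ((4 : ℕ) : ZMod (p ^ (j + 1))) := by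
  rw [ZMod.isUnit_iff_coprime, show (4 : ℕ) = 2 ^ 2 by norm_num]
  exact ((Nat.coprime_primes Nat.prime_two hp.out).2 (Ne.symm hp2)).pow 2 (j + 1)

omit [Fintype G] [DecidableEq G] in
/-- `ε ω^a = ε' ω^b` with `ε⁴ = ε'⁴ = 1` forces `a = b` in `ℤ/p^{j+1}` (`p` odd: `μ₄ ∩ μ_{p^{j+1}} = 1`, and `4` is invertible mod
`p^{j+1}`). [folklore] -/
private theorem zmod_eq_of_mul_pow_eq₄ₚₖ (hp2 : p ≠ 2) (hu : IsPrimitiveRoot (χ (Additive.ofMul u)) (p ^ (j + 1))) {ε ε' : ℂ}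
    (hε : ε ^ 4 = 1) (hε' : ε' ^ 4 = 1) {a b : ZMod (p ^ (j + 1))}
    (h : ε * χ (Additive.ofMul u) ^ a.val = ε' * χ (Additive.ofMul u) ^ b.val) : a = b := by
  haveI : NeZero (p ^ (j + 1)) := ⟨pow_ne_zero _ hp.out.ne_zero⟩
  have hn0 : 0 < p ^ (j + 1) := pow_pos hp.out.pos _
  set ω := χ (Additive.ofMul u) with hω
  have h4 : ω ^ (4 * a.val) = ω ^ (4 * b.val) := by
    have := congrArg (· ^ 4) h
    simp only [mul_pow, hε, hε', one_mul, ← pow_mul, mul_comm _ 4] at this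
    exact this
  have hmod : 4 * a.val ≡ 4 * b.val [MOD p ^ (j + 1)] := by
    have h1 := pow_mod_orderOf ω (4 * a.val)
    have h2 := pow_mod_orderOf ω (4 * b.val)
    rw [← hu.eq_orderOf] at h1 h2
    rw [← h1, ← h2] at h4
    exact hu.pow_inj (Nat.mod_lt _ hn0) (Nat.mod_lt _ hn0) h4
  have hz : ((4 * a.val : ℕ) : ZMod (p ^ (j + 1))) = ((4 * b.val : ℕ) : ZMod (p ^ (j + 1))) := (ZMod.natCast_eq_natCast_iff _ _ _).2 hmod
  push_cast at hz
  rw [ZMod.natCast_zmod_val, ZMod.natCast_zmod_val] at hz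
  have h4u' : IsUnit (4 : ZMod (p ^ (j + 1))) := by exact_mod_cast isUnit_four₄ₚₖ (p := p) (j := j) hp2
  exact h4u'.mul_left_cancel hz

omit [Fintype G] [DecidableEq G] in
/-- **The values of `χ` are `ε·ω^c`** with `ε ∈ {1, −1, i, −i}` and `c ∈ ℤ/p^{j+1}`, when `ω = χ(u)` is a primitive `p^{j+1}`-th root
of unity and all values are `4p^{j+1}`-th roots of unity (`p` odd). [folklore] -/
private theorem exists_value_eq₄ₚₖ (hp2 : p ≠ 2) (hu : IsPrimitiveRoot (χ (Additive.ofMul u)) (p ^ (j + 1)))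
    (hall : ∀ g : G, χ (Additive.ofMul g) ^ (4 * p ^ (j + 1)) = 1) (g : G) :
    ∃ ε : ℂ, (ε = 1 ∨ ε = -1 ∨ ε = Complex.I ∨ ε = -Complex.I) ∧
      ∃ c : ZMod (p ^ (j + 1)), χ (Additive.ofMul g) = ε * χ (Additive.ofMul u) ^ c.val := by
  haveI : NeZero (p ^ (j + 1)) := ⟨pow_ne_zero _ hp.out.ne_zero⟩
  set w := χ (Additive.ofMul g) with hw
  set ω := χ (Additive.ofMul u) with hω
  have hω0 : ω ≠ 0 := hu.ne_zero (pow_ne_zero _ hp.out.ne_zero)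
  have h4p : (w ^ 4) ^ p ^ (j + 1) = 1 := by rw [← pow_mul]; exact hall g
  obtain ⟨e, -, he⟩ := hu.eq_pow_of_pow_eq_one h4p
  obtain ⟨q, hq⟩ := isUnit_four₄ₚₖ (p := p) (j := j) hp2
  set c : ZMod (p ^ (j + 1)) := (e : ZMod (p ^ (j + 1))) * (↑q⁻¹ : ZMod (p ^ (j + 1))) with hc
  have h4c : (4 : ZMod (p ^ (j + 1))) * c = (e : ZMod (p ^ (j + 1))) := by
    rw [hc, ← mul_assoc, mul_comm (4 : ZMod (p ^ (j + 1))), mul_assoc]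
    have : (q : ZMod (p ^ (j + 1))) = 4 := by exact_mod_cast hq
    rw [← this, Units.mul_inv, mul_one]
  have hval : ω ^ (4 * c.val) = ω ^ e := by
    rw [← pow_mod_orderOf ω (4 * c.val), ← pow_mod_orderOf ω e, ← hu.eq_orderOf]
    congr 1
    have hz : ((4 * c.val : ℕ) : ZMod (p ^ (j + 1))) = (e : ZMod (p ^ (j + 1))) := by
      push_cast
      rw [ZMod.natCast_zmod_val]
      exact h4c
    exact (ZMod.natCast_eq_natCast_iff' _ _ _).1 hz
  set z := w * (ω ^ c.val)⁻¹ with hz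
  have hzpow : z ^ 4 = 1 := by
    rw [hz, mul_pow, ← he, ← hval, inv_pow, ← pow_mul, mul_comm c.val 4, mul_inv_cancel₀]
    exact pow_ne_zero _ hω0
  refine ⟨z, eq_of_pow_four_eq_one₄ₚₖ hzpow, c, ?_⟩
  rw [hz, inv_mul_cancel_right₀ (pow_ne_zero _ hω0)]

omit [Fintype G] [DecidableEq G] in
/-- Distinctness of `1, −1, i, −i`. [folklore] -/
private theorem four_roots_distinct₄ₚₖ :
    (1 : ℂ) ≠ -1 ∧ (1 : ℂ) ≠ Complex.I ∧ (1 : ℂ) ≠ -Complex.I ∧ (-1 : ℂ) ≠ Complex.I ∧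
      (-1 : ℂ) ≠ -Complex.I ∧ Complex.I ≠ -Complex.I := by
  refine ⟨by norm_num, fun h => ?_, fun h => ?_, fun h => ?_, fun h => ?_, fun h => ?_⟩
  · have := congrArg Complex.re h; norm_num at this
  · have := congrArg Complex.re h; norm_num at this
  · have := congrArg Complex.re h; norm_num at this
  · have := congrArg Complex.re h; norm_num at this
  · have := congrArg Complex.im h; norm_num at this
omit [Fintype G] [DecidableEq G] in
/-- **The character sum on the fibres**: `χ(S) = Σ_{d ∈ ℤ/p^{j+1}} ((N(ω^d) − N(−ω^d)) + (N(iω^d) − N(−iω^d))·i)·ω^d` with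
`N(v) = #{s ∈ S : χ(s) = v}`, for `χ` with values in the `4p^{j+1}`-th roots of unity and `ω = χ(u)` a primitive `p^{j+1}`-th root
(the case `j = 0` is the neighbour's `sum_char_eq_sum_gaussian_fibres`).
[cite: Kubota1965, §4 Lemma 2 (proof)] [cite: Hazama2003CyclicCM, Prop. 4.1] -/
theorem sum_char_eq_sum_gaussian_fibres_primePow (hp2 : p ≠ 2) (hu : IsPrimitiveRoot (χ (Additive.ofMul u)) (p ^ (j + 1)))
    (hall : ∀ g : G, χ (Additive.ofMul g) ^ (4 * p ^ (j + 1)) = 1) (Φ : Finset G) :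
    ∑ s ∈ Φ, χ (Additive.ofMul s) = ∑ d : ZMod (p ^ (j + 1)),
      ((((Φ.filter fun s => χ (Additive.ofMul s) = χ (Additive.ofMul u) ^ d.val).card : ℂ) -
          ((Φ.filter fun s => χ (Additive.ofMul s) = -χ (Additive.ofMul u) ^ d.val).card : ℂ)) +
        (((Φ.filter fun s => χ (Additive.ofMul s) = Complex.I * χ (Additive.ofMul u) ^ d.val).card : ℂ) -
          ((Φ.filter fun s => χ (Additive.ofMul s) = -(Complex.I * χ (Additive.ofMul u) ^ d.val)).card : ℂ)) *
          Complex.I) * χ (Additive.ofMul u) ^ d.val := by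
  set ω := χ (Additive.ofMul u) with hωdef
  obtain ⟨d1, d2, d3, d4, d5, d6⟩ := four_roots_distinct₄ₚₖ
  -- pointwise: exactly one of the `4p` indicator terms is `χ(s)`
  have hpt : ∀ s : G, χ (Additive.ofMul s) = ∑ d : ZMod (p ^ (j + 1)),
      ((if χ (Additive.ofMul s) = ω ^ d.val then ω ^ d.val else 0) +
        (if χ (Additive.ofMul s) = -ω ^ d.val then -ω ^ d.val else 0) +
        (if χ (Additive.ofMul s) = Complex.I * ω ^ d.val then Complex.I * ω ^ d.val else 0) +
        (if χ (Additive.ofMul s) = -(Complex.I * ω ^ d.val) then -(Complex.I * ω ^ d.val) else 0)) := by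
    intro s
    obtain ⟨ε, hε, d₀, hd₀⟩ := exists_value_eq₄ₚₖ hp2 hu hall s
    have hd₀' : χ (Additive.ofMul s) = ε * ω ^ d₀.val := hd₀
    have hε4 : ε ^ 4 = 1 := by
      rcases hε with rfl | rfl | rfl | rfl <;> norm_num [Complex.I_pow_four, neg_pow]
    -- `χ(s) = ε' ω^d` iff `(ε', d) = (ε, d₀)`
    have key : ∀ ε' : ℂ, ε' ^ 4 = 1 → ∀ d : ZMod (p ^ (j + 1)),
        (χ (Additive.ofMul s) = ε' * ω ^ d.val ↔ ε' = ε ∧ d = d₀) := by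
      intro ε' hε'4 d
      constructor
      · intro h'
        rw [hd₀'] at h'
        have hdd : d₀ = d := zmod_eq_of_mul_pow_eq₄ₚₖ hp2 hu hε4 hε'4 h'
        subst hdd
        exact ⟨(mul_right_cancel₀ (pow_ne_zero _ (hu.ne_zero (pow_ne_zero _ hp.out.ne_zero))) h').symm, rfl⟩
      · rintro ⟨rfl, rfl⟩; exact hd₀'
    have key1 : ∀ d : ZMod (p ^ (j + 1)), (χ (Additive.ofMul s) = ω ^ d.val ↔ 1 = ε ∧ d = d₀) := fun d => by
      rw [← one_mul (ω ^ d.val)]; exact key 1 (one_pow 4) d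
    have key2 : ∀ d : ZMod (p ^ (j + 1)), (χ (Additive.ofMul s) = -ω ^ d.val ↔ -1 = ε ∧ d = d₀) := fun d => by
      rw [← neg_one_mul (ω ^ d.val)]; exact key (-1) (by norm_num) d
    have key3 : ∀ d : ZMod (p ^ (j + 1)), (χ (Additive.ofMul s) = Complex.I * ω ^ d.val ↔ Complex.I = ε ∧ d = d₀) := fun d =>
      key Complex.I Complex.I_pow_four d
    have key4 : ∀ d : ZMod (p ^ (j + 1)), (χ (Additive.ofMul s) = -(Complex.I * ω ^ d.val) ↔ -Complex.I = ε ∧ d = d₀) :=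
      fun d => by
      rw [← neg_mul]; exact key (-Complex.I) (by rw [neg_pow, Complex.I_pow_four]; norm_num) d
    simp_rw [key1, key2, key3, key4]
    rw [Finset.sum_eq_single d₀]
    · rcases hε with rfl | rfl | rfl | rfl
      · rw [if_pos (show (1 : ℂ) = 1 ∧ d₀ = d₀ from ⟨rfl, rfl⟩),
          if_neg (show ¬((-1 : ℂ) = 1 ∧ d₀ = d₀) from fun h => d1 h.1.symm),
          if_neg (show ¬(Complex.I = 1 ∧ d₀ = d₀) from fun h => d2 h.1.symm),
          if_neg (show ¬(-Complex.I = 1 ∧ d₀ = d₀) from fun h => d3 h.1.symm), hd₀']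
        ring
      · rw [if_neg (show ¬((1 : ℂ) = -1 ∧ d₀ = d₀) from fun h => d1 h.1),
          if_pos (show (-1 : ℂ) = -1 ∧ d₀ = d₀ from ⟨rfl, rfl⟩),
          if_neg (show ¬(Complex.I = -1 ∧ d₀ = d₀) from fun h => d4 h.1.symm),
          if_neg (show ¬(-Complex.I = -1 ∧ d₀ = d₀) from fun h => d5 h.1.symm), hd₀']
        ring
      · rw [if_neg (show ¬((1 : ℂ) = Complex.I ∧ d₀ = d₀) from fun h => d2 h.1),
          if_neg (show ¬((-1 : ℂ) = Complex.I ∧ d₀ = d₀) from fun h => d4 h.1),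
          if_pos (show Complex.I = Complex.I ∧ d₀ = d₀ from ⟨rfl, rfl⟩),
          if_neg (show ¬(-Complex.I = Complex.I ∧ d₀ = d₀) from fun h => d6 h.1.symm), hd₀']
        ring
      · rw [if_neg (show ¬((1 : ℂ) = -Complex.I ∧ d₀ = d₀) from fun h => d3 h.1),
          if_neg (show ¬((-1 : ℂ) = -Complex.I ∧ d₀ = d₀) from fun h => d5 h.1),
          if_neg (show ¬(Complex.I = -Complex.I ∧ d₀ = d₀) from fun h => d6 h.1),
          if_pos (show -Complex.I = -Complex.I ∧ d₀ = d₀ from ⟨rfl, rfl⟩), hd₀']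
        ring
    · intro d _ hd
      have hF : ∀ ε' : ℂ, ¬(ε' = ε ∧ d = d₀) := fun ε' h => hd h.2
      rw [if_neg (hF 1), if_neg (hF (-1)), if_neg (hF Complex.I), if_neg (hF (-Complex.I))]
      ring
    · intro h'; exact absurd (Finset.mem_univ _) h'
  rw [Finset.sum_congr rfl fun s _ => hpt s, Finset.sum_comm]
  refine Finset.sum_congr rfl fun d _ => ?_
  rw [Finset.sum_add_distrib, Finset.sum_add_distrib, Finset.sum_add_distrib, ← Finset.sum_filter, ← Finset.sum_filter,
    ← Finset.sum_filter, ← Finset.sum_filter, Finset.sum_const, Finset.sum_const, Finset.sum_const, Finset.sum_const,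
    nsmul_eq_mul, nsmul_eq_mul, nsmul_eq_mul, nsmul_eq_mul]
  ring

/-- **THE VANISHING CRITERION ON THE FIBRES FOR VALUES IN THE `4p^{j+1}`-TH ROOTS OF UNITY** (any finite abelian group, `p` odd):
for an odd character `χ` (`χ(ρ) = −1`) whose values are `4p^{j+1}`-th roots of unity and contain a primitive `p^{j+1}`-th root of unity
`ω = χ(u)`, `χ(S) = 0` for a CM type `S` iff `S` meets the fibres `χ⁻¹(v)` and `χ⁻¹(vζ)` in equally many points for every value
`v = χ(g)`, where `ζ = ω^{p^j}` (a primitive `p`-th root of unity) — `S` is EQUIDISTRIBUTED among the `p` cosets of `ker χ` inside each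
coset of `ker χ^p`.  (⇒: both Gaussian coordinates of `χ(S) = Σ_c (x_c + y_c i) ω^c` are `p^j`-periodic,
`periodic_of_sum_gaussian_mul_pow_eq_zero`, and `N(v) + N(−v) = #χ⁻¹(v)`; ⇐: `ζ·χ(S) = χ(u^{p^j}S) = χ(S)`, `ζ ≠ 1`.)  The `2p^{j+1}`
analogue is the tree's `AbelianPrimePow.sum_char_eq_zero_iff_fibres`, the case `j = 0` the neighbour's `sum_char_eq_zero_iff_fibres_four_mul`.
[cite: Kubota1965, §4 Lemma 2] [cite: Hazama2003CyclicCM, Prop. 4.3 and Lemma 4.6.1] [cite: Washington1997, Prop. 2.4 and Thm. 2.5] -/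
theorem sum_char_eq_zero_iff_fibres_four_mul_primePow (hp2 : p ≠ 2) (h : IsCMTypeWith ρ (Φ : Set G))
    (hχ : χ (Additive.ofMul ρ) = -1) (hu : IsPrimitiveRoot (χ (Additive.ofMul u)) (p ^ (j + 1)))
    (hall : ∀ g : G, χ (Additive.ofMul g) ^ (4 * p ^ (j + 1)) = 1) :
    ∑ s ∈ Φ, χ (Additive.ofMul s) = 0 ↔ ∀ g : G,
      (Φ.filter fun s => χ (Additive.ofMul s) = χ (Additive.ofMul g) * χ (Additive.ofMul u) ^ p ^ j).card =
        (Φ.filter fun s => χ (Additive.ofMul s) = χ (Additive.ofMul g)).card := by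
  haveI : NeZero (p ^ (j + 1)) := ⟨pow_ne_zero _ hp.out.ne_zero⟩
  have hζ1 : χ (Additive.ofMul u) ^ p ^ j ≠ 1 :=
    hu.pow_ne_one_of_pos_of_lt (pow_ne_zero j hp.out.ne_zero) (Nat.pow_lt_pow_right hp.out.one_lt (Nat.lt_succ_self j))
  constructor
  · intro h0 g
    -- both Gaussian coordinates are `p^j`-periodic
    have hsum := sum_char_eq_sum_gaussian_fibres_primePow hp2 hu hall Φ
    obtain ⟨hxc, hyc⟩ := periodic_of_sum_gaussian_mul_pow_eq_zero hp2 hu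
      (fun d => ((Φ.filter fun s => χ (Additive.ofMul s) = χ (Additive.ofMul u) ^ d.val).card : ℤ) -
        ((Φ.filter fun s => χ (Additive.ofMul s) = -χ (Additive.ofMul u) ^ d.val).card : ℤ))
      (fun d => ((Φ.filter fun s => χ (Additive.ofMul s) = Complex.I * χ (Additive.ofMul u) ^ d.val).card : ℤ) -
        ((Φ.filter fun s => χ (Additive.ofMul s) = -(Complex.I * χ (Additive.ofMul u) ^ d.val)).card : ℤ))
      (by rw [← h0, hsum]; exact Finset.sum_congr rfl fun d _ => by push_cast; ring)
    -- the opposite fibres: `N(−v) = M_v − N(v)` with `M_v` the fibre size, constant along the four families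
    have hneg : ∀ v : ℂ, (Φ.filter fun s => χ (Additive.ofMul s) = -v).card =
        (Finset.univ.filter fun t : G => χ (Additive.ofMul t) = v).card -
          (Φ.filter fun s => χ (Additive.ofMul s) = v).card := fun v =>
      AbelianPrimePow.card_filter_neg h χ hχ v
    have hM1 : ∀ d : ZMod (p ^ (j + 1)), (Finset.univ.filter fun t : G => χ (Additive.ofMul t) = χ (Additive.ofMul u) ^ d.val).card =
        (Finset.univ.filter fun t : G => χ (Additive.ofMul t) = 1).card := fun d => by
      rw [← AbelianPrimePow.card_fibre_mul χ (u ^ d.val) 1, char_pow₄ₚₖ, mul_one]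
    have hMI : ∀ d : ZMod (p ^ (j + 1)),
        (Finset.univ.filter fun t : G => χ (Additive.ofMul t) = Complex.I * χ (Additive.ofMul u) ^ d.val).card =
          (Finset.univ.filter fun t : G => χ (Additive.ofMul t) = Complex.I).card := fun d => by
      rw [mul_comm, ← AbelianPrimePow.card_fibre_mul χ (u ^ d.val) Complex.I, char_pow₄ₚₖ]
    -- hence all four fibre counts are `p^j`-periodic in `d`
    have hN1 : ∀ d : ZMod (p ^ (j + 1)), (Φ.filter fun s => χ (Additive.ofMul s) = χ (Additive.ofMul u) ^ (d + ((p ^ j : ℕ) : ZMod (p ^ (j + 1)))).val).card =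
        (Φ.filter fun s => χ (Additive.ofMul s) = χ (Additive.ofMul u) ^ d.val).card := by
      intro d
      have h1 := hxc d
      beta_reduce at h1
      have h2 := hneg (χ (Additive.ofMul u) ^ (d + ((p ^ j : ℕ) : ZMod (p ^ (j + 1)))).val); have h3 := hneg (χ (Additive.ofMul u) ^ d.val)
      rw [hM1] at h2 h3
      omega
    have hN2 : ∀ d : ZMod (p ^ (j + 1)), (Φ.filter fun s => χ (Additive.ofMul s) = -χ (Additive.ofMul u) ^ (d + ((p ^ j : ℕ) : ZMod (p ^ (j + 1)))).val).card =
        (Φ.filter fun s => χ (Additive.ofMul s) = -χ (Additive.ofMul u) ^ d.val).card := by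
      intro d
      have h2 := hneg (χ (Additive.ofMul u) ^ (d + ((p ^ j : ℕ) : ZMod (p ^ (j + 1)))).val); have h3 := hneg (χ (Additive.ofMul u) ^ d.val)
      rw [hM1] at h2 h3
      rw [h2, h3, hN1 d]
    have hN3 : ∀ d : ZMod (p ^ (j + 1)),
        (Φ.filter fun s => χ (Additive.ofMul s) = Complex.I * χ (Additive.ofMul u) ^ (d + ((p ^ j : ℕ) : ZMod (p ^ (j + 1)))).val).card =
          (Φ.filter fun s => χ (Additive.ofMul s) = Complex.I * χ (Additive.ofMul u) ^ d.val).card := by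
      intro d
      have h1 := hyc d
      beta_reduce at h1
      have h2 := hneg (Complex.I * χ (Additive.ofMul u) ^ (d + ((p ^ j : ℕ) : ZMod (p ^ (j + 1)))).val)
      have h3 := hneg (Complex.I * χ (Additive.ofMul u) ^ d.val)
      rw [hMI] at h2 h3
      omega
    have hN4 : ∀ d : ZMod (p ^ (j + 1)),
        (Φ.filter fun s => χ (Additive.ofMul s) = -(Complex.I * χ (Additive.ofMul u) ^ (d + ((p ^ j : ℕ) : ZMod (p ^ (j + 1)))).val)).card =
          (Φ.filter fun s => χ (Additive.ofMul s) = -(Complex.I * χ (Additive.ofMul u) ^ d.val)).card := by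
      intro d
      have h2 := hneg (Complex.I * χ (Additive.ofMul u) ^ (d + ((p ^ j : ℕ) : ZMod (p ^ (j + 1)))).val)
      have h3 := hneg (Complex.I * χ (Additive.ofMul u) ^ d.val)
      rw [hMI] at h2 h3
      rw [h2, h3, hN3 d]
    -- decompose `χ(g) = ε ω^c`; then `χ(g) ζ = ε ω^{c + p^j}`
    obtain ⟨ε, hε, d, hd⟩ := exists_value_eq₄ₚₖ hp2 hu hall g
    have hshift : χ (Additive.ofMul g) * χ (Additive.ofMul u) ^ p ^ j = ε * χ (Additive.ofMul u) ^ (d + ((p ^ j : ℕ) : ZMod (p ^ (j + 1)))).val := by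
      rw [hd, pow_val_add₄ₚₖ hu d (p ^ j), mul_assoc]
    rw [hshift, hd]
    rcases hε with rfl | rfl | rfl | rfl
    · rw [one_mul, one_mul, hN1]
    · rw [neg_one_mul, neg_one_mul, hN2]
    · rw [hN3]
    · rw [neg_mul, neg_mul, hN4]
  · intro hE
    -- `ζ · χ(S) = χ(u^{p^j} S) = χ(S)`
    have hfib : ∀ F : G → ℂ, (∀ s, F s ∈ Finset.univ.image fun t : G => χ (Additive.ofMul t)) →
        ∑ s ∈ Φ, F s = ∑ v ∈ Finset.univ.image (fun t : G => χ (Additive.ofMul t)),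
          ((Φ.filter fun s => F s = v).card : ℂ) * v := by
      intro F hF
      rw [← Finset.sum_fiberwise_of_maps_to (g := F) fun s _ => hF s]
      refine Finset.sum_congr rfl fun v _ => ?_
      rw [Finset.sum_congr rfl fun s hs => by rw [(Finset.mem_filter.1 hs).2], Finset.sum_const, nsmul_eq_mul]
    have hT : ∑ s ∈ Φ, χ (Additive.ofMul s) = ∑ v ∈ Finset.univ.image (fun t : G => χ (Additive.ofMul t)),
        ((Φ.filter fun s => χ (Additive.ofMul s) = v).card : ℂ) * v :=
      hfib _ fun s => Finset.mem_image.2 ⟨s, Finset.mem_univ _, rfl⟩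
    have hTu : ∑ s ∈ Φ, χ (Additive.ofMul (s * u ^ p ^ j)) = ∑ v ∈ Finset.univ.image (fun t : G => χ (Additive.ofMul t)),
        ((Φ.filter fun s => χ (Additive.ofMul (s * u ^ p ^ j)) = v).card : ℂ) * v :=
      hfib _ fun s => Finset.mem_image.2 ⟨s * u ^ p ^ j, Finset.mem_univ _, rfl⟩
    have hcount : ∀ v ∈ Finset.univ.image (fun t : G => χ (Additive.ofMul t)),
        (Φ.filter fun s => χ (Additive.ofMul (s * u ^ p ^ j)) = v).card =
          (Φ.filter fun s => χ (Additive.ofMul s) = v).card := by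
      intro v hv
      obtain ⟨g₀, -, rfl⟩ := Finset.mem_image.1 hv
      have hg : χ (Additive.ofMul g₀) = χ (Additive.ofMul (g₀ * (u ^ p ^ j)⁻¹)) * χ (Additive.ofMul u) ^ p ^ j := by
        rw [← char_pow₄ₚₖ, ← char_mul₄ₚₖ, inv_mul_cancel_right]
      have key := hE (g₀ * (u ^ p ^ j)⁻¹)
      rw [← hg] at key
      rw [key]
      congr 1
      refine Finset.filter_congr fun s _ => ?_
      rw [char_mul₄ₚₖ, char_pow₄ₚₖ, hg]
      exact ⟨fun h' => mul_right_cancel₀ (pow_ne_zero _ (char_ne_zero₄ₚₖ χ u)) h', fun h' => by rw [h']⟩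
    have hζT : (∑ s ∈ Φ, χ (Additive.ofMul s)) * χ (Additive.ofMul u) ^ p ^ j = ∑ s ∈ Φ, χ (Additive.ofMul s) := by
      rw [Finset.sum_mul, Finset.sum_congr rfl fun s _ => by rw [← char_pow₄ₚₖ, ← char_mul₄ₚₖ], hTu, hT]
      exact Finset.sum_congr rfl fun v hv => by rw [hcount v hv]
    have : (∑ s ∈ Φ, χ (Additive.ofMul s)) * (χ (Additive.ofMul u) ^ p ^ j - 1) = 0 := by
      rw [mul_sub, mul_one, hζT, sub_self]
    exact (mul_eq_zero.1 this).resolve_right (sub_ne_zero.2 hζ1)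

end Values

/-! ## §3 Kernels of index `4p^{j+1}`: the characters of a cyclic quotient of order `4p^{j+1}` vanish iff the type is equidistributed
along the subgroup of order `p` -/

section IndexFourMulPrimePow

variable [hp : Fact p.Prime] {j : ℕ}

omit [Fintype G] [DecidableEq G] hp in
/-- `χ(g)^{[G : ker χ]} = 1`. [folklore] -/
private theorem char_pow_index_eq_one₄ₚₖ [Finite G] {H : Subgroup G} (χ : AddChar (Additive G) ℂ)
    (hker : ∀ g : G, χ (Additive.ofMul g) = 1 ↔ g ∈ H) (g : G) : χ (Additive.ofMul g) ^ H.index = 1 := by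
  rw [← char_pow₄ₚₖ, hker]
  exact Subgroup.pow_index_mem H g

omit [Fintype G] [DecidableEq G] hp in
/-- A character whose kernel misses the involution `ρ` is odd. [folklore] -/
private theorem odd_of_ker₄ₚₖ {H : Subgroup G} (hρH : ρ ∉ H) (hρ2 : ρ * ρ = 1) (χ : AddChar (Additive G) ℂ)
    (hker : ∀ g : G, χ (Additive.ofMul g) = 1 ↔ g ∈ H) : χ (Additive.ofMul ρ) = -1 := by
  have hsq : χ (Additive.ofMul ρ) * χ (Additive.ofMul ρ) = 1 := by rw [← char_mul₄ₚₖ, hρ2, char_one₄ₚₖ]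
  rcases mul_self_eq_one_iff.1 hsq with h1 | h1
  · exact absurd ((hker ρ).1 h1) hρH
  · exact h1

omit [Fintype G] [DecidableEq G] in
/-- For `ker χ` of index `4p^{j+1}` with cyclic quotient, the fourth power of a generator has `χ`-value a primitive `p^{j+1}`-th root
of unity. [folklore] -/
private theorem exists_isPrimitiveRoot_of_index_four_mul_primePow [Finite G] {H : Subgroup G} (χ : AddChar (Additive G) ℂ)
    (hker : ∀ g : G, χ (Additive.ofMul g) = 1 ↔ g ∈ H) (hidx : H.index = 4 * p ^ (j + 1)) (hcyc : IsCyclic (G ⧸ H)) :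
    ∃ u : G, IsPrimitiveRoot (χ (Additive.ofMul u)) (p ^ (j + 1)) := by
  haveI := hcyc
  obtain ⟨γ, hγ⟩ := IsCyclic.exists_generator (α := G ⧸ H)
  obtain ⟨σ, rfl⟩ := QuotientGroup.mk_surjective γ
  have hσN : orderOf (σ : G ⧸ H) = 4 * p ^ (j + 1) := by
    rw [orderOf_eq_card_of_forall_mem_zpowers hγ, ← Subgroup.index_eq_card, hidx]
  have hprim : IsPrimitiveRoot (χ (Additive.ofMul σ)) (4 * p ^ (j + 1)) := by
    rw [IsPrimitiveRoot.iff_def]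
    have hk : ∀ k : ℕ, χ (Additive.ofMul σ) ^ k = 1 ↔ 4 * p ^ (j + 1) ∣ k := fun k => by
      rw [← char_pow₄ₚₖ, hker, ← QuotientGroup.eq_one_iff, QuotientGroup.mk_pow, ← hσN, orderOf_dvd_iff_pow_eq_one]
    exact ⟨(hk _).2 dvd_rfl, fun l hl => (hk l).1 hl⟩
  refine ⟨σ ^ 4, ?_⟩
  rw [char_pow₄ₚₖ]
  exact hprim.pow (mul_pos four_pos (pow_pos hp.out.pos _)) rfl

/-- **VANISHING AT A KERNEL OF INDEX `4p^{j+1}` IS EQUIDISTRIBUTION ALONG THE SUBGROUP OF ORDER `p`** (any finite abelian group `G`,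
`p` odd): an odd character `χ` whose kernel `H` has index `4p^{j+1}` and cyclic quotient vanishes on the CM type `S` iff
`#(S ∩ gxH) = #(S ∩ gH)` for every `g ∈ G` and every `x` with `x^p ∈ H` — verbatim the condition of the index-`2p^{j+1}` kernels (tree
`…equidistributed_of_index`) and of the index-`4p` kernels (neighbour `…equidistributed_of_index_four_mul`, `j = 0`).  On a CM field:
the characters belonging to a CM subfield `F` of degree `4p^{j+1}` with CYCLIC `Gal(F/ℚ)` vanish on the type iff the multiplicities of
`Φ|_F` are constant along the orbits of the subgroup of order `p` of `Gal(F/ℚ)`. [cite: Kubota1965, §4 Lemma 2]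
[cite: Hazama2003CyclicCM, Prop. 4.3 and Lemma 4.6.1] [cite: Washington1997, Prop. 2.4 and Thm. 2.5] -/
theorem sum_char_eq_zero_iff_equidistributed_of_index_four_mul_primePow (hp2 : p ≠ 2) (h : IsCMTypeWith ρ (Φ : Set G))
    (χ : AddChar (Additive G) ℂ) (hχ : χ (Additive.ofMul ρ) = -1) {H : Subgroup G}
    (hker : ∀ g : G, χ (Additive.ofMul g) = 1 ↔ g ∈ H) (hidx : H.index = 4 * p ^ (j + 1)) (hcyc : IsCyclic (G ⧸ H)) :
    ∑ s ∈ Φ, χ (Additive.ofMul s) = 0 ↔ ∀ x : G, x ^ p ∈ H → ∀ g : G,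
      (Φ.filter fun s => (g * x)⁻¹ * s ∈ H).card = (Φ.filter fun s => g⁻¹ * s ∈ H).card := by
  obtain ⟨u, hu⟩ := exists_isPrimitiveRoot_of_index_four_mul_primePow χ hker hidx hcyc
  have hall : ∀ g : G, χ (Additive.ofMul g) ^ (4 * p ^ (j + 1)) = 1 := fun g => by
    rw [← hidx]; exact char_pow_index_eq_one₄ₚₖ χ hker g
  have hζ : IsPrimitiveRoot (χ (Additive.ofMul u) ^ p ^ j) p := hu.pow (pow_pos hp.out.pos _) (pow_succ p j)
  rw [sum_char_eq_zero_iff_fibres_four_mul_primePow hp2 h hχ hu hall]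
  -- coset counts versus fibre counts
  have hcos : ∀ g : G, (Φ.filter fun s => g⁻¹ * s ∈ H) =
      Φ.filter fun s => χ (Additive.ofMul s) = χ (Additive.ofMul g) := fun g =>
    Finset.filter_congr fun s _ => (char_eq_iff_inv_mul_mem₄ₚₖ χ hker g s).symm
  constructor
  · intro crit x hx g
    have iter : ∀ (i : ℕ) (g : G),
        (Φ.filter fun s => χ (Additive.ofMul s) = χ (Additive.ofMul g) * (χ (Additive.ofMul u) ^ p ^ j) ^ i).card =
          (Φ.filter fun s => χ (Additive.ofMul s) = χ (Additive.ofMul g)).card := by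
      intro i
      induction i with
      | zero => intro g; simp only [pow_zero, mul_one]
      | succ i ih =>
        intro g
        have hval : χ (Additive.ofMul g) * (χ (Additive.ofMul u) ^ p ^ j) ^ (i + 1) =
            χ (Additive.ofMul (g * (u ^ p ^ j) ^ i)) * χ (Additive.ofMul u) ^ p ^ j := by
          rw [char_mul₄ₚₖ, char_pow₄ₚₖ, char_pow₄ₚₖ, pow_succ, mul_assoc]
        rw [hval, crit (g * (u ^ p ^ j) ^ i), char_mul₄ₚₖ, char_pow₄ₚₖ, char_pow₄ₚₖ]
        exact ih g
    have hxp : χ (Additive.ofMul x) ^ p = 1 := by rw [← char_pow₄ₚₖ, hker]; exact hx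
    obtain ⟨i, -, hi⟩ := hζ.eq_pow_of_pow_eq_one hxp
    have key := iter i g
    rw [hi, ← char_mul₄ₚₖ, ← hcos, ← hcos] at key
    exact key
  · intro hEQ g
    have hx : (u ^ p ^ j) ^ p ∈ H := by
      rw [← hker, char_pow₄ₚₖ, char_pow₄ₚₖ, ← pow_mul, ← pow_succ, hu.pow_eq_one]
    have key := hEQ (u ^ p ^ j) hx g
    rw [hcos, hcos, char_mul₄ₚₖ, char_pow₄ₚₖ] at key
    exact key

omit [DecidableEq G] in
/-- **All characters of an index-`4p^{j+1}` kernel at once**: for `H ∌ ρ` with `G/H` cyclic of order `4p^{j+1}`, the characters with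
kernel `H` vanish on `S` iff `S` is equidistributed at `H` along the subgroup of order `p` (so `H` contributes `φ(4p^{j+1}) = 2(p−1)p^j` to
Kubota's defect iff so). [cite: Kubota1965, §4 Lemma 2] [cite: Hazama2003CyclicCM, Prop. 4.3] [cite: White1993SporadicCycles, §4, proof of Lemma 3 (p. 131)] -/
theorem forall_sum_char_eq_zero_iff_equidistributed_of_index_four_mul_primePow (hp2 : p ≠ 2) (h : IsCMTypeWith ρ (Φ : Set G))
    {H : Subgroup G} (hρH : ρ ∉ H) (hcyc : IsCyclic (G ⧸ H)) (hidx : H.index = 4 * p ^ (j + 1)) :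
    (∀ χ : AddChar (Additive G) ℂ, (∀ g : G, χ (Additive.ofMul g) = 1 ↔ g ∈ H) →
        ∑ s ∈ Φ, χ (Additive.ofMul s) = 0) ↔
      ∀ x : G, x ^ p ∈ H → ∀ g : G,
        (Φ.filter fun s => (g * x)⁻¹ * s ∈ H).card = (Φ.filter fun s => g⁻¹ * s ∈ H).card := by
  have hρ2 := rho_mul_rho₄ₚₖ h
  rw [forall_sum_char_eq_zero_iff_exists hρH hρ2 hcyc Φ]
  constructor
  · rintro ⟨ψ, hψ, h0⟩
    exact (sum_char_eq_zero_iff_equidistributed_of_index_four_mul_primePow hp2 h ψ (odd_of_ker₄ₚₖ hρH hρ2 ψ hψ) hψ hidx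
      hcyc).1 h0
  · intro hEQ
    obtain ⟨χ, hχρ, hker⟩ := exists_oddChar_ker hρH hρ2 hcyc
    exact ⟨χ, hker, (sum_char_eq_zero_iff_equidistributed_of_index_four_mul_primePow hp2 h χ hχρ hker hidx hcyc).2 hEQ⟩

end IndexFourMulPrimePow

end AbelianKernels

end CyclicCMType

end Literature.NumberTheory.ComplexMultiplication

end
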